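import Mathlib
import Literature.Probability.LatticeModels.ProdBernoulliIndependence
import Literature.Probability.Percolation.SharpnessDCTProofs
import Literature.Probability.Percolation.PercolationProofs
import HarnessLib

/-!
# Crux `PercNearOneGluing.NearOneGluing` (stmt-CriticalPhenomena-4574), line `live-seal-vanishing-sprinkle`
# — stub `stub_transferIneq` (the transfer inequality)

Helper file for the crux skeleton `Cruxes/NearOneGluing/Lines/live-seal-vanishing-sprinkle.lean`
(lead prover-line-stmt-CriticalPhenomena-4574-a1-0).  Proves exactly the registered stub signature;
lands with `--supports stmt-CriticalPhenomena-4574`.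

TRANSFER INEQUALITY (the card's FIRST LEMMA).  `μ = prodBernoulli w` on the bond configurations
`ω : Set (Sym2 (Fin n))` of the complete weighted graph on `Fin n`; `T` a fixed vertex set with
`b ∉ T`, `E ∋ a` a fixed set of relays, `L ω` the LIVE boundary pairs of `T` towards `b`
(`s(x, y)` with `x ∈ T`, `y ∉ T`, `y ↔ b` inside `(↑T)ᶜ`).  Then
`∫ 1{∀ e ∈ E, e ↮ b inside (↑T)ᶜ} · ∏_{e ∈ L ω} (1 - w e) dμ ≤ μ(a ↮ b)`.

Proof.
* `D = {∀ e ∈ E, e ↮ b in (↑T)ᶜ}` and every level set `{L = F}` are determined by the pairs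
  inside `(↑T)ᶜ` (`DCT16.determinedBy_openConnIn`), while a value `F = L ω₀` consists of pairs
  incident to `T`; so `{all pairs of F closed}` (determined by `F`) is independent of
  `D ∩ {L = F}` and `μ(D ∩ {L = F}) · ∏_{e ∈ F} (1 - w e) = μ(D ∩ {L = F} ∩ {F closed})`
  (`prodBernoulli_real_inter_of_determinedBy`, `prodBernoulli_real_forall_notMem`);
* summing over the finitely many values `F` (the space is finite, the integral is a finite sum):
  `∫ 1_D κ(L) dμ = Σ_F μ(D ∩ {L = F} ∩ {F closed})`;
* deterministic inclusion `D ∩ {L = F} ∩ {F closed} ⊆ {L = F} ∩ {a ↮ b}`: follow an open `b → a`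
  path from `b ∉ T`; if it stays in `(↑T)ᶜ` then `a ↔ b` inside `(↑T)ᶜ`, contradicting `D`
  (`a ∈ E`); otherwise its first exit edge `y ∼ x` (`y ∉ T`, `x ∈ T`, preceded by a path inside
  `(↑T)ᶜ` from `b`) is a live pair `s(x, y) ∈ L ω = F`, and it is open — contradiction;
* the level sets `{L = F}` partition the space, so the sum is `≤ μ(a ↮ b)`.
-/

namespace Summit.CriticalPhenomena.PercolationContinuityZ3.Theorems

open scoped BigOperators Classical
open MeasureTheory Set
open Literature.Probability.LatticeModels (prodBernoulli prodBernoulli_real_inter_of_determinedBy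
  prodBernoulli_real_forall_notMem)
open Literature.Probability.Percolation

/-! ### Finite-space bookkeeping -/

section FiniteSpace

variable {Ω β : Type*} [MeasurableSpace Ω] [MeasurableSingletonClass Ω] [Finite Ω] [Fintype β]

/-- On a finite measurable space, `∫ 1_D(ω) · c(L ω) dν = Σ_F ν(D ∩ {L = F}) · c(F)`: partition
according to the (finitely many) values of `L`. -/
theorem transferIneq_integral_indicator_comp (ν : Measure Ω) [IsFiniteMeasure ν] (D : Set Ω)
    (L : Ω → β) (c : β → ℝ) :
    ∫ ω, D.indicator (fun ω => c (L ω)) ω ∂ν = ∑ F, ν.real (D ∩ {ω | L ω = F}) * c F := by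
  have hg : (fun ω => D.indicator (fun ω => c (L ω)) ω) =
      fun ω => ∑ F, (D ∩ {ω | L ω = F}).indicator (fun _ => c F) ω := by
    funext ω
    by_cases hω : ω ∈ D
    · rw [Set.indicator_of_mem hω]
      have h1 : ∀ F, (D ∩ {ω | L ω = F}).indicator (fun _ => c F) ω =
          if L ω = F then c F else 0 := by
        intro F
        by_cases hF : L ω = F
        · rw [if_pos hF, Set.indicator_of_mem (show ω ∈ D ∩ {ω | L ω = F} from ⟨hω, hF⟩)]
        · rw [if_neg hF, Set.indicator_of_notMem (fun h : ω ∈ D ∩ {ω | L ω = F} => hF h.2)]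
      simp only [h1, Finset.sum_ite_eq, Finset.mem_univ, if_true]
    · rw [Set.indicator_of_notMem hω]
      exact (Finset.sum_eq_zero fun F _ =>
        Set.indicator_of_notMem (fun h : ω ∈ D ∩ {ω | L ω = F} => hω h.1) _).symm
  rw [hg, integral_finsetSum _ fun F _ => Integrable.of_finite]
  refine Finset.sum_congr rfl fun F _ => ?_
  have hm : MeasurableSet (D ∩ {ω | L ω = F}) := (Set.toFinite _).measurableSet
  rw [integral_indicator_const (c F) hm, smul_eq_mul]

/-- On a finite measurable space, `Σ_F ν({L = F} ∩ G) = ν(G)`: the level sets of `L` partition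
the space. -/
theorem transferIneq_sum_measureReal_fiber (ν : Measure Ω) [IsFiniteMeasure ν] (L : Ω → β)
    (G : Set Ω) : ∑ F, ν.real ({ω | L ω = F} ∩ G) = ν.real G := by
  rw [← measureReal_biUnion_finset]
  · congr 1
    ext ω
    simp
  · intro F _ F' _ hFF'
    exact Set.disjoint_left.2 fun ω h h' => hFF' (h.1.symm.trans h'.1)
  · exact fun F _ => (Set.toFinite _).measurableSet

end FiniteSpace

/-! ### The live pairs and the cut event only see the pairs inside `(↑T)ᶜ` -/

section Determined

variable {V : Type*} (T : Finset V) (b : V) (L : Set (Sym2 V) → Finset (Sym2 V))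
  (hL : ∀ ω e, e ∈ L ω ↔ ∃ x ∈ T, ∃ y ∉ T, e = s(x, y) ∧ ω ∈ openConnIn ((↑T : Set V)ᶜ) y b)
include hL

/-- Configurations agreeing on the pairs inside `(↑T)ᶜ` have the same live pairs. -/
theorem transferIneq_L_congr {ω ω' : Set (Sym2 V)}
    (h : ω ∩ ((↑T : Set V)ᶜ).sym2 = ω' ∩ ((↑T : Set V)ᶜ).sym2) : L ω = L ω' := by
  have key : ∀ y, ω ∈ openConnIn ((↑T : Set V)ᶜ) y b ↔ ω' ∈ openConnIn ((↑T : Set V)ᶜ) y b :=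
    fun y => (determinedBy_iff _ _).1 (DCT16.determinedBy_openConnIn _ y b le_rfl) ω ω' h
  ext e
  simp only [hL, key]

/-- The live pairs are incident to `T`, hence none of them is a pair inside `(↑T)ᶜ`. -/
theorem transferIneq_coe_L_subset (ω : Set (Sym2 V)) :
    (↑(L ω) : Set (Sym2 V)) ⊆ (((↑T : Set V)ᶜ).sym2)ᶜ := by
  intro e he hmem
  obtain ⟨x, hx, y, -, rfl, -⟩ := (hL ω e).1 (Finset.mem_coe.1 he)
  exact (Set.mk_mem_sym2_iff.1 hmem).1 (Finset.mem_coe.2 hx)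

/-- The cut event `{∀ e ∈ E, e ↮ b in (↑T)ᶜ}` met with a level set `{L = F}` of the live pairs is
determined by the pairs inside `(↑T)ᶜ`. -/
theorem transferIneq_determinedBy_piece (E : Finset V) (F : Finset (Sym2 V)) :
    DeterminedBy ({ω | ∀ e ∈ E, ω ∉ openConnIn ((↑T : Set V)ᶜ) e b} ∩ {ω | L ω = F})
      (((↑T : Set V)ᶜ).sym2) := by
  rw [determinedBy_iff]
  intro ω ω' h
  have key : ∀ y, ω ∈ openConnIn ((↑T : Set V)ᶜ) y b ↔ ω' ∈ openConnIn ((↑T : Set V)ᶜ) y b :=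
    fun y => (determinedBy_iff _ _).1 (DCT16.determinedBy_openConnIn _ y b le_rfl) ω ω' h
  simp only [Set.mem_inter_iff, Set.mem_setOf_eq, key, transferIneq_L_congr T b L hL h]

end Determined

/-! ### The last-`T`-vertex argument -/

/-- **Deterministic core.** If every relay `e ∈ E` is cut from `b` inside `(↑T)ᶜ` (`a ∈ E`,
`b ∉ T`) and every pair `s(x, y)` with `x ∈ T`, `y ∉ T`, `y ↔ b` inside `(↑T)ᶜ` belongs to a set
`F` of closed pairs, then `a ↮ b`: an open path from `b` either stays inside `(↑T)ᶜ` and reaches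
`a` there, or leaves `(↑T)ᶜ` for the first time through an open pair `s(x, y) ∈ F`. -/
theorem transferIneq_not_reachable {V : Type*} {T E : Finset V} {a b : V} (ha : a ∈ E)
    (hb : b ∉ T) {ω : Set (Sym2 V)} {F : Finset (Sym2 V)}
    (hF : ∀ x ∈ T, ∀ y ∉ T, ω ∈ openConnIn ((↑T : Set V)ᶜ) y b → s(x, y) ∈ F)
    (hD : ∀ e ∈ E, ω ∉ openConnIn ((↑T : Set V)ᶜ) e b) (hcl : ∀ e ∈ F, e ∉ ω) :
    ¬ (openGraph ω).Reachable a b := by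
  intro hab
  have hbS : b ∈ ((↑T : Set V)ᶜ : Set V) := Set.mem_compl fun h => hb (Finset.mem_coe.1 h)
  have hP : PathIn (openGraph ω) Set.univ b a := (DCT16.pathIn_univ_of_reachable hab).symm
  rcases hP.exit_or hbS with h | ⟨y, x, hy, hx, -, hadj, hpath⟩
  · exact hD a ha (DCT16.mem_openConnIn_of_pathIn (h.mono Set.inter_subset_left).symm)
  · have hxT : x ∈ T := Finset.mem_coe.1 (Set.notMem_compl_iff.1 hx)
    have hyT : y ∉ T := fun h => hy (Finset.mem_coe.2 h)
    have hyb : ω ∈ openConnIn ((↑T : Set V)ᶜ) y b :=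
      DCT16.mem_openConnIn_of_pathIn (hpath.mono Set.inter_subset_left).symm
    have hopen : s(y, x) ∈ ω := ((openGraph_adj ω y x).1 hadj).1
    rw [Sym2.eq_swap] at hopen
    exact hcl _ (hF x hxT y hyT hyb) hopen

/-! ### The transfer inequality -/

/-- Registered stub `stub_transferIneq` of crux stmt-CriticalPhenomena-4574 (line
live-seal-vanishing-sprinkle): **transfer inequality.** For a fixed vertex set `T ∌ b`, a fixed
finite set `E ∋ a` and the live boundary pairs `L ω` of `T` towards `b` (`s(x,y)`, `x ∈ T`,
`y ∉ T`, `y ↔ b` inside `(↑T)ᶜ`):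
`∫ 1{∀ e ∈ E, e ↮ b inside (↑T)ᶜ} · ∏_{e ∈ L ω} (1 - w e) dμ ≤ μ(a ↮ b)`.
See the module docstring for the proof. -/
theorem stub_transferIneq (n : ℕ) (w : Sym2 (Fin n) → unitInterval) (T E : Finset (Fin n))
    (a b : Fin n) (ha : a ∈ E) (hb : b ∉ T)
    (L : Set (Sym2 (Fin n)) → Finset (Sym2 (Fin n)))
    (hL : ∀ ω e, e ∈ L ω ↔
      ∃ x ∈ T, ∃ y ∉ T, e = s(x, y) ∧ ω ∈ openConnIn ((↑T : Set (Fin n))ᶜ) y b) :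
    ∫ ω, ({ω | ∀ e ∈ E, ω ∉ openConnIn ((↑T : Set (Fin n))ᶜ) e b}.indicator
        (fun ω => ∏ e ∈ L ω, (1 - (w e : ℝ))) ω) ∂(prodBernoulli w)
      ≤ (prodBernoulli w).real (openConn a b)ᶜ := by
  set D : Set (Set (Sym2 (Fin n))) :=
    {ω | ∀ e ∈ E, ω ∉ openConnIn ((↑T : Set (Fin n))ᶜ) e b} with hD
  -- (1) the integral is a finite sum over the values of `L`
  have hint : ∫ ω, D.indicator (fun ω => ∏ e ∈ L ω, (1 - (w e : ℝ))) ω ∂(prodBernoulli w) =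
      ∑ F, (prodBernoulli w).real (D ∩ {ω | L ω = F}) * ∏ e ∈ F, (1 - (w e : ℝ)) :=
    transferIneq_integral_indicator_comp (prodBernoulli w) D L fun F => ∏ e ∈ F, (1 - (w e : ℝ))
  -- (2) independence of `{F closed}` (pairs incident to `T`) from `D ∩ {L = F}` (pairs inside `Tᶜ`)
  have hterm : ∀ F : Finset (Sym2 (Fin n)),
      (prodBernoulli w).real (D ∩ {ω | L ω = F}) * ∏ e ∈ F, (1 - (w e : ℝ)) =
        (prodBernoulli w).real ({ω | ∀ e ∈ F, e ∉ ω} ∩ (D ∩ {ω | L ω = F})) := by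
    intro F
    by_cases hF : ∃ ω₀, L ω₀ = F
    · obtain ⟨ω₀, rfl⟩ := hF
      rw [← prodBernoulli_real_forall_notMem w (L ω₀), mul_comm]
      refine (prodBernoulli_real_inter_of_determinedBy w (L ω₀) (determinedBy_forall_notMem (L ω₀))
        ?_ MeasurableSet.of_discrete MeasurableSet.of_discrete).symm
      exact (transferIneq_determinedBy_piece T b L hL E (L ω₀)).mono
        (Set.subset_compl_comm.1 (transferIneq_coe_L_subset T b L hL ω₀))
    · have hempty : D ∩ {ω | L ω = F} = ∅ :=
        Set.eq_empty_iff_forall_notMem.2 fun ω h => hF ⟨ω, h.2⟩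
      rw [hempty, Set.inter_empty, measureReal_empty, zero_mul]
  -- (3) deterministic inclusion, level set by level set
  have hincl : ∀ F : Finset (Sym2 (Fin n)),
      {ω | ∀ e ∈ F, e ∉ ω} ∩ (D ∩ {ω | L ω = F}) ⊆ {ω | L ω = F} ∩ (openConn a b)ᶜ := by
    rintro F ω ⟨hcl, hωD, hLF⟩
    refine ⟨hLF, ?_⟩
    have hF' : ∀ x ∈ T, ∀ y ∉ T, ω ∈ openConnIn ((↑T : Set (Fin n))ᶜ) y b → s(x, y) ∈ F :=
      fun x hx y hy hyb => hLF ▸ (hL ω _).2 ⟨x, hx, y, hy, rfl, hyb⟩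
    exact transferIneq_not_reachable ha hb hF' hωD hcl
  -- (4) assemble
  rw [hint]
  calc ∑ F, (prodBernoulli w).real (D ∩ {ω | L ω = F}) * ∏ e ∈ F, (1 - (w e : ℝ))
      = ∑ F, (prodBernoulli w).real ({ω | ∀ e ∈ F, e ∉ ω} ∩ (D ∩ {ω | L ω = F})) :=
        Finset.sum_congr rfl fun F _ => hterm F
    _ ≤ ∑ F, (prodBernoulli w).real ({ω | L ω = F} ∩ (openConn a b)ᶜ) :=
        Finset.sum_le_sum fun F _ => measureReal_mono (hincl F)
    _ = (prodBernoulli w).real (openConn a b)ᶜ :=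
        transferIneq_sum_measureReal_fiber (prodBernoulli w) L _

end Summit.CriticalPhenomena.PercolationContinuityZ3.Theorems
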